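import Literature.AnabelianGeometry.EtaleTheta.Discharge.Sec1Fdd2OfSection
import Literature.AnabelianGeometry.EtaleTheta.ContH1ComplementsPowerLimit
import Literature.AnabelianGeometry.EtaleTheta.ThetaCohomologyInfRes
import Literature.AnabelianGeometry.EtaleTheta.ContH1Injectivity
import Literature.AnabelianGeometry.EtaleTheta.Discharge.Sec1Prop15iiSchema
import Mathlib.NumberTheory.Cyclotomic.CyclotomicCharacter
import HarnessLib

/-!
# [EtTh] Prop. 1.5 (ii)/(i) as THEOREMS over the Kummer datum of a Kummer core and a Galois section
# (FACT-LIST rows F-2503 `Prop15ii` / F-2502 `Prop15i` at `KummerCore.toKummerDataOfSection`; proof-only)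

Mochizuki, *The étale theta function …*, Publ. RIMS **45** (2009) [EtTh], §1, Prop. 1.5 p. 23 (printed 249)
[cite: MochizukiEtTh2009, Prop 1.5 p.23]: (ii) "`F̈⁰/F̈¹ = Hom(Δ_Θ, Δ_Θ) = Ẑ·log(Θ)`; `F̈¹/F̈² = … = Ẑ·log(Ü)`;
`F̈² = H¹(G_K̈, Δ_Θ) →̃ H¹(G_K̈, Ẑ(1)) →̃ (K̈^×)^∧`"; (i) the same on `Y`.

PROOF-ONLY (abc-iut cell, row R179/R184 of abc-iut-L2-lead "F-2503 FACTS → THEOREMS", seat abc-iut-L6-d5 gen 4;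
no definition / instance / `Prop` fact). Over the FROZEN predicates of abc-iut-L2-t1 (`ThetaCohomology.lean`),
abc-iut-w5-d171's `KummerCore` and abc-iut-L2-t6's `KummerCore.toKummerDataOfSection` (the datum whose carriers ARE
print's `H¹(G_K, Δ_Θ)`, `H¹(G_K̈, Δ_Θ)`, computed through a continuous Galois section `s` with `aug ∘ s = id`,
`s(G_K) ≤ Π^tp_Y`, `s(G_K̈) ≤ Π^tp_Ÿ`), for ANY theta setting, core and section — no model, no origin guard:

* clause (c): the `Ÿ`-clause `F̈² = range kumYdd` is abc-iut-w5-d140's `Fdd2_eq_range_kumYdd_of_section`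
  (`Sec1Fdd2OfSection.lean`, consumed BY NAME); here its form for ANY pair `aug(H) ≤ H₀`, `s(H₀) ≤ H`
  (`ker_res_eq_range_kumOfSection`: a class killed on the geometric part `(H ∩ Δ^tp_X)^Θ` is a cocycle vanishing
  there ON THE NOSE — that part centralises `Δ_Θ`, `ContH1.res_mk_eq_one_iff_of_conj_trivial` — hence constant on
  `augTheta`-fibres, hence pulled back through `s`) and the `Y`-clause `F2_eq_range_kumY_ofSection` of row F-2502;
* the power-limit binder of abc-iut-L2-t12's `res_deltaTheta_surjective_of_complement_of_tendsto_zpow`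
  DISCHARGED from the core (`exists_tendsto_zpow_conj`): conjugation by any `k ∈ (Π^tp_X)^Θ` on
  `Δ_Θ = coeffHom(Λ(ℚ̄_p^×))` is the limit of `a ↦ aⁿ` along the cyclotomic congruence filter
  `⨅_N 𝓟{n | σ z = zⁿ on μ_N}`, `σ = augTheta k` (`μ_N(ℚ̄_p)` cyclic); so clause (a) `res_deltaTheta_surjective`
  needs a topological complement of `Δ_Θ` ALONE (`res_deltaTheta_surjective_of_complement`) or ONE lift of
  `log(Θ)` (`…_of_res_eq_logTheta`, L2-t12's converse); `Δ_Θ` is torsion-free given a core, so the (b)-clauses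
  of (i)/(ii) are interchangeable WITHOUT the origin guard (`logUdd_mem_Fdd1_of_logU_mem_F1`; cf. abc-iut-f-140);
* assembly: `prop15ii_ofSection_of_complement` / `…_of_res_eq_logTheta` — `Prop15ii E hC` for the section
  datum from a complement of `Δ_Θ` in `(Π^tp_Ÿ)^Θ` (resp. a lift of `log(Θ)`) and the ONE datum clause
  `log(Ü) ∈ F̈¹` (no axiom of `KummerCore` constrains the datum `log(Ü)`; at the χ-twisted model it is the
  explicit coordinate class); `Y`-twins `prop15i_ofSection_…` and both rows from ONE splitting of `(Π^tp_Y)^Θ`.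

HONEST NOTE: for w5-d171's other datum `KummerCore.toKummerData` (`KddHat := K̈^×`, a SUB-object of `(K̈^×)^∧`)
clause (c) cannot hold at a genuine model (`F̈² ≅ (K̈^×)^∧ ⊋ K̈^×`): (ii) is a theorem over the SECTION datum. Group
cohomology over the typed interface; nothing of [EtTh] asserted beyond what is proved; no side on [IUTchIII] 3.12.
-/

noncomputable section

namespace Literature.AnabelianGeometry.EtaleTheta

open Literature.AnabelianGeometry.SemiGraphs Literature.NumberTheory.GaloisRepresentations
open _root_.Filter _root_.Topology
open scoped IsMulCommutative

/-! ### Generic: restriction to a subgroup acting trivially vanishes iff the cocycle vanishes there -/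

namespace ContH1

variable {G G' : Type*} [Group G] [TopologicalSpace G]
  [Group G'] [TopologicalSpace G'] [IsTopologicalGroup G']
  {φ : G →* G'} {A : Subgroup G'} [A.Normal] [IsMulCommutative A] {N H : Subgroup G}

/-- If `N ≤ H` acts TRIVIALLY on `A` through `φ`, then the restriction to `N` of the class of a cocycle `f` on
`H` vanishes iff `f` vanishes on `N` ON THE NOSE (the only coboundary of `N` is `1`).
[cite: NeukirchSchmidtWingberg2008, I §2 and II §7] -/
theorem res_mk_eq_one_iff_of_conj_trivial (hNH : N ≤ H)
    (htriv : ∀ n ∈ N, ∀ a : A, MulAut.conjNormal (φ n) a = a)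
    (f : H → A) (hf : f ∈ contCocycles φ A H) :
    ContH1.res φ A hNH (ContH1.mk f hf) = 1 ↔ ∀ n : N, f ⟨n.1, hNH n.2⟩ = 1 := by
  change ContH1.mk _ (ContH1.resCocycle φ A hNH ⟨f, hf⟩).2 = 1 ↔ _
  rw [ContH1.mk_eq_one_iff, mem_contCoboundaries_iff]
  constructor
  · rintro ⟨a, ha⟩ n
    have h := congrFun ha n
    rw [htriv n.1 n.2 a, mul_inv_cancel] at h
    exact h
  · intro h
    refine ⟨1, funext fun n => ?_⟩
    rw [map_one, mul_inv_cancel]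
    exact h n

end ContH1

/-! ### `G_{ℚ_p}` acts on roots of unity by power maps -/

/-- Every `σ ∈ G_{ℚ_p}` acts on the `N`-th roots of unity of `ℚ̄_p` as ONE power map `z ↦ z^m` (`μ_N(ℚ̄_p)` is
cyclic; Mathlib's `rootsOfUnity.integer_power_of_ringEquiv'`). [cite: NeukirchSchmidtWingberg2008, I §2 and II §7] -/
theorem exists_smul_units_eq_pow_of_pow_eq_one {p : ℕ} [Fact p.Prime] (σ : GQp p) (N : ℕ+) :
    ∃ m : ℤ, ∀ z : (PadicAlgCl p)ˣ, z ^ (N : ℕ) = 1 → σ • z = z ^ m := by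
  haveI : NeZero (N : ℕ) := ⟨N.ne_zero⟩
  obtain ⟨m, hm⟩ := rootsOfUnity.integer_power_of_ringEquiv' (N : ℕ) (σ.toRingEquiv) (L := PadicAlgCl p)
  refine ⟨m, fun z hz => Units.ext ?_⟩
  exact hm z ((mem_rootsOfUnity _ z).mpr hz)

namespace ThetaSetting

variable {p : ℕ} [Fact p.Prime] {D : ThetaSetting p}

/-- The geometric part `(H ∩ Δ^tp_X)^Θ` of `H^Θ` acts trivially on `Δ_Θ` (`Δ_Θ` is central in `(Δ^tp_X)^Θ`,
p. 12). [cite: MochizukiEtTh2009, §1 p.12] -/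
theorem conjNormal_eq_of_mem_geometric (H : Subgroup D.PiTemp) :
    ∀ n ∈ (H ⊓ D.DeltaTemp).map D.toTheta, ∀ a : D.DeltaTheta,
      MulAut.conjNormal (MonoidHom.id D.GtpTheta n) a = a :=
  fun _ hn a => D.conjNormal_eq_of_mem_map_deltaTemp (Subgroup.map_mono inf_le_right hn) a

namespace KummerCore

variable (C : D.KummerCore)
  (s : GQp p →* D.PiTemp) (hs : Continuous s) (hsec : ∀ σ : GQp p, D.aug (s σ) = σ)

/-! ### Inflation–restriction through the section: `Ker(res to the geometric part) = range (kumOfSection)` -/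

/-- `augTheta` kills the geometric part `(H ∩ Δ^tp_X)^Θ`. [cite: MochizukiEtTh2009, Prop 1.5 p.23] -/
theorem augTheta_eq_one_of_mem {H : Subgroup D.PiTemp} {n : D.GtpTheta}
    (hn : n ∈ (H ⊓ D.DeltaTemp).map D.toTheta) : C.augTheta n = 1 := by
  obtain ⟨g, hg, rfl⟩ := hn
  rw [C.augTheta_toTheta]
  exact hg.2

include hsec in
/-- **The fibre step.** For `h ∈ H^Θ` with `aug(H) ≤ H₀`, `s(H₀) ≤ H`: the element `h⁻¹ · toTheta(s(augTheta h))`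
lies in the geometric part `(H ∩ Δ^tp_X)^Θ`. [cite: MochizukiEtTh2009, Prop 1.5 p.23] -/
theorem inv_mul_toTheta_section_mem {H : Subgroup D.PiTemp} {H₀ : Subgroup (GQp p)}
    (hH₀ : H.map D.aug.toMonoidHom ≤ H₀) (hsH : H₀.map s ≤ H) {h : D.GtpTheta}
    (hh : h ∈ H.map D.toTheta) :
    h⁻¹ * D.toTheta (s (C.augTheta h)) ∈ (H ⊓ D.DeltaTemp).map D.toTheta := by
  obtain ⟨g, hg, rfl⟩ := hh
  have haug : D.aug g ∈ H₀ := hH₀ ⟨g, hg, rfl⟩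
  have hsg : s (D.aug g) ∈ H := hsH ⟨D.aug g, haug, rfl⟩
  refine ⟨g⁻¹ * s (D.aug g), ⟨H.mul_mem (H.inv_mem hg) hsg, ?_⟩, ?_⟩
  · change D.aug.toMonoidHom (g⁻¹ * s (D.aug g)) = 1
    rw [map_mul, map_inv]
    change (D.aug g)⁻¹ * D.aug (s (D.aug g)) = 1
    rw [hsec, inv_mul_cancel]
  · rw [map_mul, map_inv, C.augTheta_toTheta]

include hs hsec in
/-- **Inflation–restriction through the section.** For `H ≤ Π^tp_X`, `H₀ ≤ G_{ℚ_p}` with `aug(H) ≤ H₀`, `s(H₀) ≤ H`,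
the kernel of restriction `H¹(H^Θ, Δ_Θ) → H¹((H ∩ Δ^tp_X)^Θ, Δ_Θ)` is EXACTLY the range of `kumOfSection :
H¹(H₀, Δ_Θ) → H¹(H^Θ, Δ_Θ)` — print's "`F² = H¹(G_K, Δ_Θ)`" through the section. [cite: MochizukiEtTh2009, Prop 1.5 p.23] -/
theorem ker_res_eq_range_kumOfSection (H : Subgroup D.PiTemp) (H₀ : Subgroup (GQp p))
    (hH₀ : H.map D.aug.toMonoidHom ≤ H₀) (hsH : H₀.map s ≤ H)
    (hH' : (H.map D.toTheta).map C.augTheta ≤ H₀) :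
    (ContH1.res (MonoidHom.id D.GtpTheta) D.DeltaTheta
        (Subgroup.map_mono inf_le_left : (H ⊓ D.DeltaTemp).map D.toTheta ≤ H.map D.toTheta)).ker =
      (C.kumOfSection s hsec (H.map D.toTheta) H₀ hH').range := by
  have hle : (H ⊓ D.DeltaTemp).map D.toTheta ≤ H.map D.toTheta := Subgroup.map_mono inf_le_left
  have hsΘ : ∀ σ : H₀, D.toTheta (s σ) ∈ H.map D.toTheta := fun σ => ⟨s σ, hsH ⟨σ.1, σ.2, rfl⟩, rfl⟩
  ext x
  constructor
  · -- a class killed on the geometric part is inflated through the section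
    intro hx
    rw [MonoidHom.mem_ker] at hx
    induction x using QuotientGroup.induction_on with
    | H f =>
      have hf0 : ∀ n : ↥((H ⊓ D.DeltaTemp).map D.toTheta), f.1 ⟨n.1, hle n.2⟩ = 1 :=
        (ContH1.res_mk_eq_one_iff_of_conj_trivial hle (conjNormal_eq_of_mem_geometric H) f.1 f.2).mp hx
      -- the cocycle on `H₀` through the section
      let f₀ : H₀ → D.DeltaTheta := fun σ => f.1 ⟨D.toTheta (s σ), hsΘ σ⟩
      have hf₀ : f₀ ∈ contCocycles (D.toTheta.comp s) D.DeltaTheta H₀ := by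
        refine ⟨f.2.1.comp ?_, fun σ τ => ?_⟩
        · exact ((D.continuous_toTheta.comp hs).comp continuous_subtype_val).subtype_mk _
        · have hmul : (⟨D.toTheta (s (σ * τ : H₀)), hsΘ (σ * τ)⟩ : ↥(H.map D.toTheta)) =
              ⟨D.toTheta (s σ), hsΘ σ⟩ * ⟨D.toTheta (s τ), hsΘ τ⟩ :=
            Subtype.ext (by simp only [Subgroup.coe_mul, map_mul])
          change f.1 _ = f.1 _ * MulAut.conjNormal _ (f.1 _)
          rw [hmul, f.2.2]
          rfl
      refine ⟨ContH1.mk f₀ hf₀, ?_⟩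
      rw [C.kumOfSection_mk s hsec]
      change ContH1.mk _ _ = ContH1.mk f.1 f.2
      refine ContH1.mk_congr _ (funext fun h => ?_) _ _
      -- `f(toTheta (s (augTheta h))) = f h`: the two arguments differ by an element of the geometric part
      have hmem := C.inv_mul_toTheta_section_mem s hsec hH₀ hsH h.2
      have hdec : (⟨D.toTheta (s (C.augTheta h.1)), hsΘ ⟨C.augTheta h.1, hH' ⟨h.1, h.2, rfl⟩⟩⟩ :
            ↥(H.map D.toTheta)) = h * ⟨_, hle hmem⟩ :=
        Subtype.ext (by rw [Subgroup.coe_mul]; exact (mul_inv_cancel_left _ _).symm)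
      change f.1 ⟨D.toTheta (s (C.augTheta h.1)), _⟩ = f.1 h
      rw [hdec, f.2.2, hf0 ⟨_, hmem⟩, map_one, mul_one]
  · -- an inflated class dies on the geometric part: `augTheta` kills it
    rintro ⟨y, rfl⟩
    rw [MonoidHom.mem_ker]
    induction y using QuotientGroup.induction_on with
    | H f₀ =>
      change ContH1.res _ _ hle (C.kumOfSection s hsec _ H₀ hH' (ContH1.mk f₀.1 f₀.2)) = 1
      rw [C.kumOfSection_mk s hsec]
      refine (ContH1.res_mk_eq_one_iff_of_conj_trivial hle (conjNormal_eq_of_mem_geometric H) _ _).mpr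
        fun n => ?_
      have h1 : (⟨C.augTheta n.1, hH' ⟨n.1, hle n.2, rfl⟩⟩ : H₀) = 1 :=
        Subtype.ext (C.augTheta_eq_one_of_mem n.2)
      change f₀.1 ⟨C.augTheta n.1, _⟩ = 1
      rw [h1]
      exact ContH1.cocycle_map_one f₀

/-! ### Clause (c) on `Y`: `F² = range (kumY)` for the section datum (`Ÿ`: abc-iut-w5-d140) -/

section ClauseC

variable (hsY : D.GK.map s ≤ D.GtpY) (hsYdd : D.GKdd.map s ≤ D.GtpYdd)

include hs hsec in
/-- **Prop. 1.5 (i), clause (c), PROVED for the section datum**: `F² = H¹(G_K, Δ_Θ)` = the range of `kumY`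
("`F² = H¹(G_K, Δ_Θ) →̃ (K^×)^∧`", p. 23) — the `Y`-twin of abc-iut-w5-d140's `Fdd2_eq_range_kumYdd_of_section`
(`Sec1Fdd2OfSection.lean`, the `Ÿ`-clause, consumed below BY NAME). [cite: MochizukiEtTh2009, Prop 1.5 (i) p.23] -/
theorem F2_eq_range_kumY_ofSection :
    (F2 : Subgroup (D.H1Theta (D.GtpY.map D.toTheta))) =
      (C.toKummerDataOfSection s hs hsec hsY hsYdd).kumY.range :=
  C.ker_res_eq_range_kumOfSection s hs hsec D.GtpY D.GK D.map_aug_GtpY.le hsY C.map_augTheta_gtpY.le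

include hs hsec in
/-- The unit Kummer classes of the section datum restrict trivially to `Δ_Θ` (`range kumYdd = F̈² ≤ F̈¹`; the
(ii)-type input of abc-iut-L2-t6's `prop15iii_etaleThetaDataOfClass_of_lift`). [cite: MochizukiEtTh2009, Prop 1.5 (ii) p.23] -/
theorem kumYdd_ofSection_mem_Fdd1 (hC : D.Compat) (c : (C.toKummerDataOfSection s hs hsec hsY hsYdd).KddHat) :
    (C.toKummerDataOfSection s hs hsec hsY hsYdd).kumYdd c ∈ Fdd1 hC :=
  Fdd2_le_Fdd1 hC (by rw [C.Fdd2_eq_range_kumYdd_of_section s hs hsec hsY hsYdd]; exact ⟨c, rfl⟩)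

end ClauseC

/-! ### The power-limit hypothesis from the core: conjugation on `Δ_Θ` is a limit of power maps -/

section PowerLimit

include C in
/-- **Conjugation on `Δ_Θ` is a pointwise limit of power maps** (the binder `hpow` of abc-iut-L2-t12's
`res_surjective_of_complement_of_tendsto_zpow`, DISCHARGED for every `k ∈ (Π^tp_X)^Θ` from the core):
`Δ_Θ = coeffHom(Λ(ℚ̄_p^×))` equivariantly and `σ = augTheta k` acts on `Λ` as the limit of `ζ ↦ ζⁿ` along the
non-trivial cyclotomic congruence filter `⨅_N 𝓟 {n | σ z = zⁿ on μ_N}` (p. 12). [cite: MochizukiEtTh2009, §1 p.12] -/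
theorem exists_tendsto_zpow_conj (k : D.GtpTheta) :
    ∃ l : Filter ℤ, l.NeBot ∧
      ∀ a a' : D.DeltaTheta, k * (a : D.GtpTheta) * k⁻¹ = a' → Tendsto (fun n : ℤ => a ^ n) l (𝓝 a') := by
  let S : ℕ+ → Set ℤ := fun N =>
    {n | ∀ z : (PadicAlgCl p)ˣ, z ^ (N : ℕ) = 1 → C.augTheta k • z = z ^ n}
  have hanti : ∀ M N : ℕ+, S (M * N) ⊆ S M := fun M N n hn z hz =>
    hn z (by rw [PNat.mul_coe, pow_mul, hz, one_pow])
  have hanti' : ∀ M N : ℕ+, S (M * N) ⊆ S N := fun M N => by rw [mul_comm]; exact hanti N M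
  have hdir : Directed (· ≥ ·) fun N => 𝓟 (S N) := fun M N =>
    ⟨M * N, principal_mono.2 (hanti M N), principal_mono.2 (hanti' M N)⟩
  have hne : ∀ N, (𝓟 (S N)).NeBot := fun N =>
    principal_neBot_iff.2 (exists_smul_units_eq_pow_of_pow_eq_one (C.augTheta k) N)
  refine ⟨⨅ N, 𝓟 (S N), iInf_neBot_of_directed' hdir hne, fun a a' h => ?_⟩
  obtain ⟨ζ, rfl⟩ := C.bijective_coeffHom.2 a
  have ha' : a' = C.coeffHom (C.augTheta k • ζ) := by
    apply Subtype.ext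
    rw [C.coeffHom_smul, MulAut.conjNormal_apply, ← h]
  rw [ha']
  have hpow : (fun n : ℤ => C.coeffHom ζ ^ n) = fun n => C.coeffHom (ζ ^ n) :=
    funext fun n => (map_zpow C.coeffHom ζ n).symm
  rw [hpow]
  refine (C.continuous_coeffHom.tendsto _).comp ?_
  rw [tendsto_subtype_rng, tendsto_pi_nhds]
  intro N
  have hS : S N ∈ ⨅ N, 𝓟 (S N) := mem_iInf_of_mem N (mem_principal_self _)
  refine (tendsto_const_nhds (x := ((C.augTheta k • ζ : cyclotome (PadicAlgCl p)ˣ) : ℕ+ → (PadicAlgCl p)ˣ) N)).congr' ?_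
  filter_upwards [hS] with n hn
  rw [SubgroupClass.coe_zpow, Pi.pow_apply, cyclotome.smul_apply]
  exact hn _ (cyclotome.pow_eq_one ζ N)

include C in
/-- **`Δ_Θ` is torsion-free** given a Kummer core (`Λ(ℚ̄_p^×)` is: a compatible system of roots of unity killed by
`n ≠ 0` is trivial). [cite: MochizukiEtTh2009, §1 p.12] -/
theorem deltaTheta_eq_one_of_pow_eq_one {n : ℕ} (hn : n ≠ 0) (a : D.DeltaTheta) (ha : a ^ n = 1) : a = 1 := by
  obtain ⟨ζ, rfl⟩ := C.bijective_coeffHom.2 a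
  rw [← map_pow] at ha
  have hζ : ζ ^ n = 1 := C.bijective_coeffHom.1 (by rw [ha, map_one])
  have h1 : ζ = 1 := by
    apply Subtype.ext
    funext m
    have hm := cyclotome.pow_apply_mul ζ m ⟨n, Nat.pos_of_ne_zero hn⟩
    have hmn : (ζ : ℕ+ → (PadicAlgCl p)ˣ) (m * ⟨n, Nat.pos_of_ne_zero hn⟩) ^ n = 1 := by
      have := congrArg (fun ξ : cyclotome (PadicAlgCl p)ˣ => (ξ : ℕ+ → (PadicAlgCl p)ˣ) (m * ⟨n, Nat.pos_of_ne_zero hn⟩)) hζ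
      simpa using this
    rw [← hm]
    exact hmn
  rw [h1, map_one]

include C in
/-- Hence **no `n`-torsion in `H¹(Δ_Θ, Δ_Θ) = Hom(Δ_Θ, Δ_Θ)`** (`n ≠ 0`) given a core — abc-iut-f-117's
`h1Theta_deltaTheta_eq_one_of_pow_eq_one` WITHOUT the origin guard. [cite: MochizukiEtTh2009, Prop 1.5 (i) p.23] -/
theorem h1Theta_deltaTheta_eq_one_of_pow_eq_one {n : ℕ} (hn : n ≠ 0) (c : D.H1Theta D.DeltaTheta)
    (hc : c ^ n = 1) : c = 1 := by
  refine ContH1.eq_one_of_pow_eq_one_of_conj_trivial (fun h a => ?_) (fun a ha => C.deltaTheta_eq_one_of_pow_eq_one hn a ha) c hc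
  apply Subtype.ext
  rw [MulAut.conjNormal_apply, MonoidHom.id_apply]
  rw [← D.ker_thetaToEll_comm a.1 a.2 h.1 h.2, mul_inv_cancel_right]

include C in
/-- **(i)(b) ⇒ (ii)(b) without the origin guard**, for any Kummer datum over a setting with a core:
`log(U) ∈ F¹ ⇒ log(Ü) ∈ F̈¹` (`(log(Ü)|_{Δ_Θ})² = log(U)|_{Δ_Θ} = 1` and no `2`-torsion; cf. abc-iut-f-140's
`KummerData.logUdd_mem_Fdd1_of_logU_mem_F1`, which assumes `IsEtThOrigin`). [cite: MochizukiEtTh2009, Prop 1.5 (ii) p.23] -/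
theorem logUdd_mem_Fdd1_of_logU_mem_F1 (hC : D.Compat) (K : D.KummerData) (h : K.logU ∈ F1 hC) :
    K.logUdd ∈ Fdd1 hC := by
  -- `(log(Ü)|_{Δ_Θ})² = (log(U)|_Ÿ)|_{Δ_Θ} = log(U)|_{Δ_Θ} = 1`
  have e : ContH1.res (MonoidHom.id D.GtpTheta) D.DeltaTheta
        (hC.deltaTheta_le_DtpYddTheta.trans (Subgroup.map_mono inf_le_left)) K.logUdd ^ 2 =
      ContH1.res (MonoidHom.id D.GtpTheta) D.DeltaTheta
        ((hC.deltaTheta_le_DtpYddTheta.trans (Subgroup.map_mono inf_le_left)).trans D.GtpYddTheta_le)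
        K.logU :=
    ((map_pow _ K.logUdd 2).symm.trans (congrArg _ K.res_logU.symm)).trans (ContH1.res_res _ _ _)
  exact C.h1Theta_deltaTheta_eq_one_of_pow_eq_one two_ne_zero _ (e.trans h)

end PowerLimit

/-! ### Clause (a): `res_deltaTheta_surjective` from a complement (or a lift of `log(Θ)`) ALONE -/

section ClauseA

variable [T2Space D.GtpTheta]

include C in
/-- **`F⁰/F¹ = Hom(Δ_Θ, Δ_Θ)` from a topological splitting alone** (given a core): if `H' = Δ_Θ ⋊ K`
topologically (`Δ_Θ ≤ H' ≤ (Π^tp_X)^Θ`, continuous `Δ_Θ`-coordinate `π` with `π(h)⁻¹ h ∈ K`, `Δ_Θ ⊓ K = ⊥`), then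
restriction `H¹(H', Δ_Θ) → H¹(Δ_Θ, Δ_Θ)` is SURJECTIVE — abc-iut-L2-t12's
`res_deltaTheta_surjective_of_complement_of_tendsto_zpow` with its power-limit binder supplied by
`exists_tendsto_zpow_conj`. [cite: MochizukiEtTh2009, Prop 1.5 (i) p.23] -/
theorem res_deltaTheta_surjective_of_complement {H' K : Subgroup D.GtpTheta} (hΔ : D.DeltaTheta ≤ H')
    (hdisj : Disjoint D.DeltaTheta K) (π : H' → D.DeltaTheta)
    (hπK : ∀ h : H', ((π h : D.GtpTheta))⁻¹ * (h : D.GtpTheta) ∈ K) (hπc : Continuous π) :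
    Function.Surjective
      (ContH1.res (MonoidHom.id D.GtpTheta) D.DeltaTheta hΔ : D.H1Theta H' → D.H1Theta D.DeltaTheta) :=
  res_deltaTheta_surjective_of_complement_of_tendsto_zpow hΔ hdisj π hπK hπc fun k _ =>
    C.exists_tendsto_zpow_conj k

include C in
/-- **… or from ONE lift of `log(Θ)`**: a class of `H¹(H', Δ_Θ)` restricting to `log(Θ)` splits `H'`
(abc-iut-L2-t12's `exists_complement_of_res_eq_logTheta`), so restriction to `Δ_Θ` is surjective.
[cite: MochizukiEtTh2009, Prop 1.5 (iii) p.23] -/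
theorem res_deltaTheta_surjective_of_res_eq_logTheta {H' : Subgroup D.GtpTheta} (hΔ : D.DeltaTheta ≤ H')
    (x : D.H1Theta H') (hx : ContH1.res (MonoidHom.id D.GtpTheta) D.DeltaTheta hΔ x = D.logTheta) :
    Function.Surjective
      (ContH1.res (MonoidHom.id D.GtpTheta) D.DeltaTheta hΔ : D.H1Theta H' → D.H1Theta D.DeltaTheta) := by
  obtain ⟨K, -, hdisj, r, hrc, -, hrK, -⟩ := exists_complement_of_res_eq_logTheta hΔ x hx
  exact C.res_deltaTheta_surjective_of_complement hΔ hdisj r hrK hrc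

end ClauseA

/-! ### Assembly: `Prop15ii` / `Prop15i` for the section datum -/

section Assembly

variable (hsY : D.GK.map s ≤ D.GtpY) (hsYdd : D.GKdd.map s ≤ D.GtpYdd) [T2Space D.GtpTheta]

include hs hsec in
/-- **[EtTh] Prop. 1.5 (ii) as a THEOREM for the section datum, from a topological complement of `Δ_Θ` in
`(Π^tp_Ÿ)^Θ`** and the one datum clause `log(Ü) ∈ F̈¹`: `Prop15ii (C.toKummerDataOfSection s …) hC` — the
FACT-LIST row F-2503 in the consumers' binder shape, over ANY theta setting with a Kummer core and a Galois section.
[cite: MochizukiEtTh2009, Prop 1.5 (ii) p.23] -/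
theorem prop15ii_ofSection_of_complement (hC : D.Compat) {K : Subgroup D.GtpTheta}
    (hdisj : Disjoint D.DeltaTheta K) (π : ↥(D.GtpYdd.map D.toTheta) → D.DeltaTheta)
    (hπK : ∀ h : ↥(D.GtpYdd.map D.toTheta), ((π h : D.GtpTheta))⁻¹ * (h : D.GtpTheta) ∈ K)
    (hπc : Continuous π) (hUdd : C.logUdd ∈ Fdd1 hC) :
    Prop15ii (C.toKummerDataOfSection s hs hsec hsY hsYdd) hC :=
  C.prop15ii_of_section s hs hsec hsY hsYdd hC (C.res_deltaTheta_surjective_of_complement _ hdisj π hπK hπc) hUdd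

include hs hsec in
/-- **[EtTh] Prop. 1.5 (ii) for the section datum, from ONE lift of `log(Θ)` to `(Π^tp_Ÿ)^Θ`** (e.g. a lifted
étale theta class) and `log(Ü) ∈ F̈¹`. [cite: MochizukiEtTh2009, Prop 1.5 (ii) p.23] -/
theorem prop15ii_ofSection_of_res_eq_logTheta (hC : D.Compat) (x : D.H1Theta (D.GtpYdd.map D.toTheta))
    (hx : ContH1.res (MonoidHom.id D.GtpTheta) D.DeltaTheta
      (hC.deltaTheta_le_DtpYddTheta.trans (Subgroup.map_mono inf_le_left)) x = D.logTheta)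
    (hUdd : C.logUdd ∈ Fdd1 hC) :
    Prop15ii (C.toKummerDataOfSection s hs hsec hsY hsYdd) hC :=
  C.prop15ii_of_section s hs hsec hsY hsYdd hC (C.res_deltaTheta_surjective_of_res_eq_logTheta _ x hx) hUdd

include hs hsec in
/-- **[EtTh] Prop. 1.5 (i) as a THEOREM for the section datum, from a topological complement of `Δ_Θ` in
`(Π^tp_Y)^Θ`** and `log(U) ∈ F¹` (row F-2502). [cite: MochizukiEtTh2009, Prop 1.5 (i) p.23] -/
theorem prop15i_ofSection_of_complement (hC : D.Compat) {K : Subgroup D.GtpTheta}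
    (hdisj : Disjoint D.DeltaTheta K) (π : ↥(D.GtpY.map D.toTheta) → D.DeltaTheta)
    (hπK : ∀ h : ↥(D.GtpY.map D.toTheta), ((π h : D.GtpTheta))⁻¹ * (h : D.GtpTheta) ∈ K)
    (hπc : Continuous π) (hU : C.logU ∈ F1 hC) :
    Prop15i (C.toKummerDataOfSection s hs hsec hsY hsYdd) hC where
  res_deltaTheta_surjective := C.res_deltaTheta_surjective_of_complement _ hdisj π hπK hπc
  logU_mem_F1 := hU
  F2_eq := C.F2_eq_range_kumY_ofSection s hs hsec hsY hsYdd

include hs hsec in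
/-- **Both rows at once from ONE splitting of `(Π^tp_Y)^Θ`** and `log(U) ∈ F¹`: the complement of `Δ_Θ` in
`(Π^tp_Y)^Θ` restricts to one in `(Π^tp_Ÿ)^Θ` (abc-iut-f-140: (i)(a) ⇒ (ii)(a)), and `log(U) ∈ F¹ ⇒ log(Ü) ∈ F̈¹`
(no guard, `logUdd_mem_Fdd1_of_logU_mem_F1`). [cite: MochizukiEtTh2009, Prop 1.5 p.23] -/
theorem prop15i_and_prop15ii_ofSection_of_complement (hC : D.Compat) {K : Subgroup D.GtpTheta}
    (hdisj : Disjoint D.DeltaTheta K) (π : ↥(D.GtpY.map D.toTheta) → D.DeltaTheta)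
    (hπK : ∀ h : ↥(D.GtpY.map D.toTheta), ((π h : D.GtpTheta))⁻¹ * (h : D.GtpTheta) ∈ K)
    (hπc : Continuous π) (hU : C.logU ∈ F1 hC) :
    Prop15i (C.toKummerDataOfSection s hs hsec hsY hsYdd) hC ∧
      Prop15ii (C.toKummerDataOfSection s hs hsec hsY hsYdd) hC := by
  have h1 := C.prop15i_ofSection_of_complement s hs hsec hsY hsYdd hC hdisj π hπK hπc hU
  refine ⟨h1, ⟨?_, C.logUdd_mem_Fdd1_of_logU_mem_F1 hC _ hU, C.Fdd2_eq_range_kumYdd_of_section s hs hsec hsY hsYdd⟩⟩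
  -- (i)(a) ⇒ (ii)(a): restriction to `Δ_Θ` from `Y` factors through `Ÿ`
  intro c
  obtain ⟨x, hx⟩ := h1.res_deltaTheta_surjective c
  exact ⟨ContH1.res (MonoidHom.id D.GtpTheta) D.DeltaTheta D.GtpYddTheta_le x,
    (ContH1.res_res _ _ x).trans hx⟩

end Assembly

end KummerCore

end ThetaSetting

end Literature.AnabelianGeometry.EtaleTheta

end
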